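/-
Copyright (c) 2026. All rights reserved.
Released under Apache 2.0 license as described in the file LICENSE.
Authors: abc-iut cell, prover seat abc-iut-L1-d9 (gen 10).
-/
import Literature.NumberTheory.DiophantineGeometry.GenEllMellProofs
import Mathlib.AlgebraicGeometry.EllipticCurve.ModelsWithJ
import HarnessLib

/-!
# Kernel closure census of `MellHasFinitelyManyPoints` ([GenEll] Ex. 1.3 (i) for `M_ell`)

S. Mochizuki, *Arithmetic elliptic curves in general position*, Math. J. Okayama Univ. 52 (2010)
[cite: MochizukiGenEll2010] (kurims manuscript, Feb. 2009), read on the page: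

> Ex. 1.3 (i) (p. 5): "If `E ⊆ X(Q̄)` is a subset such that each `E^{≤d}` [where `d` ranges over the
> positive integers] is finite, then we shall say that `E` is Galois-finite."
> Prop. 3.4 (p. 17): "In particular, if `C ∈ ℝ`, then the set of points `[E] ∈ M_ell(Q̄)^{≤d}` such
> that `ht^Falt([E]) ≤ C` is finite."

PROOF-ONLY file (no new definitions), companion of `GenEllVocabularyClosures.lean` for the one
[GenEll] vocabulary predicate of `GenEllMell.lean` in the cell's frozen fact list that that file does
not cover: row **F-2758** `MellHasFinitelyManyPoints (S : Set EllPoint) : Prop` — "the presented points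
of `S ⊆ M_ell(Q̄)` have finitely many `j`-invariants up to conjugacy" (counted through
`minpoly ℚ j(E)`).  It is a **predicate with a free parameter** `S`, i.e. the "is finite" of the
printed sentences above, not a published theorem.  This file records, in the kernel:

* the UNIVERSAL CLOSURE is FALSE: already `M_ell(Q̄)^{≤1}` is not finite — the `ℚ`-curves with
  `j`-invariant `n = 0, 1, 2, …` (Mathlib's models `WeierstrassCurve.ofJ n`, elliptic with
  `j(ofJ n) = n`) have the pairwise distinct minimal polynomials `X − n`
  (`not_mellHasFinitelyManyPoints_mellLe_one`, `not_mellHasFinitelyManyPoints_univ`,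
  `not_forall_mellHasFinitelyManyPoints`); so the row is not a theorem to prove and not an
  assumption to bind unapplied;
* the predicate is INHABITED and its exact threshold on the degree filtration:
  `MellHasFinitelyManyPoints (MellLe d) ↔ d = 0` (`MellLe 0 = ∅` since a presenting number field has
  positive degree), and every finite set of presented points qualifies
  (`MellHasFinitelyManyPoints.of_finite`);
* the INSTANCES OF RECORD are the tree's theorems, cited by name and not restated here:
  `northcott_htInf d C : MellHasFinitelyManyPoints {P | P ∈ MellLe d ∧ P.htInf ≤ C}` (uniform
  Northcott for `j`-invariants, [GenEll] Prop. 1.4 (iv) for `(M̄_ell, 𝒪(∞_M))`) and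
  `prop34Finite_holds` (the finiteness clause of Prop. 3.4), both in `GenEllMellProofs.lean`.

Nothing here is deep.  Classical; no bearing on, and no side taken on, [IUTchIII] Cor. 3.12.
`typed ≠ proved`; a fact-list row is an assumption label, not an endorsement.
-/

noncomputable section

open Polynomial Set

namespace Literature.NumberTheory.DiophantineGeometry.GenEll

/-! ## The `ℚ`-points `j = q` of `M_ell` -/

/-- The point `[E] ∈ M_ell(Q̄)` with `j(E) = q ∈ ℚ`, presented over `ℚ` by Mathlib's model
`WeierstrassCurve.ofJ q`, has degree `[ℚ:ℚ] = 1`. [cite: MochizukiGenEll2010, Ex 1.3 (i) p.5] -/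
theorem degree_mk_rat_ofJ (q : ℚ) : (EllPoint.mk ℚ (WeierstrassCurve.ofJ q)).degree = 1 := by
  unfold EllPoint.degree
  exact Module.finrank_self ℚ

/-- … so it lies in `M_ell(Q̄)^{≤d}` for every `d ≥ 1`. [cite: MochizukiGenEll2010, Ex 1.3 (i) p.5] -/
theorem mk_rat_ofJ_mem_mellLe {d : ℕ} (hd : 1 ≤ d) (q : ℚ) :
    EllPoint.mk ℚ (WeierstrassCurve.ofJ q) ∈ MellLe d := by
  change (EllPoint.mk ℚ (WeierstrassCurve.ofJ q)).degree ≤ d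
  rw [degree_mk_rat_ofJ]
  exact hd

/-- The invariant through which points of `M_ell(Q̄)` are counted, at the `ℚ`-point `j = q`:
`minpoly_ℚ(j(ofJ q)) = X − q`. [cite: MochizukiGenEll2010, Ex 1.3 (i) p.5] -/
theorem minpoly_j_mk_rat_ofJ (q : ℚ) :
    minpoly ℚ (EllPoint.mk ℚ (WeierstrassCurve.ofJ q)).W.j = X - C q := by
  change minpoly ℚ (WeierstrassCurve.ofJ q).j = X - C q
  rw [WeierstrassCurve.ofJ_j]
  exact minpoly.eq_X_sub_C' q

/-- The counting invariant separates the `ℚ`-points `j = n`, `n ∈ ℕ`: `n ↦ minpoly_ℚ(j(ofJ n))` is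
injective. [cite: MochizukiGenEll2010, Ex 1.3 (i) p.5] -/
theorem minpoly_j_mk_rat_ofJ_natCast_injective :
    Function.Injective fun n : ℕ => minpoly ℚ (EllPoint.mk ℚ (WeierstrassCurve.ofJ (n : ℚ))).W.j := by
  intro m n h
  have h' : (X - C (m : ℚ) : ℚ[X]) = X - C (n : ℚ) := by
    rw [← minpoly_j_mk_rat_ofJ (m : ℚ), ← minpoly_j_mk_rat_ofJ (n : ℚ)]
    exact h
  have hC : (C (m : ℚ) : ℚ[X]) = C (n : ℚ) := sub_right_injective h'
  exact_mod_cast (C_inj.mp hC)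

/-! ## The universal closure of F-2758 is false -/

/-- **`M_ell(Q̄)^{≤1}` does not have finitely many points**: the `ℚ`-curves `ofJ n` (`n ∈ ℕ`) have
pairwise non-conjugate `j`-invariants `n`. [cite: MochizukiGenEll2010, Ex 1.3 (i) p.5] -/
theorem not_mellHasFinitelyManyPoints_mellLe_one : ¬ MellHasFinitelyManyPoints (MellLe 1) := by
  unfold MellHasFinitelyManyPoints
  refine Set.infinite_of_injective_forall_mem minpoly_j_mk_rat_ofJ_natCast_injective fun n => ?_
  exact Set.mem_image_of_mem _ (mk_rat_ofJ_mem_mellLe le_rfl (n : ℚ))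

/-- Hence `M_ell(Q̄)^{≤d}` does not have finitely many points for any `d ≥ 1`.
[cite: MochizukiGenEll2010, Ex 1.3 (i) p.5] -/
theorem not_mellHasFinitelyManyPoints_mellLe {d : ℕ} (hd : 1 ≤ d) :
    ¬ MellHasFinitelyManyPoints (MellLe d) := fun h =>
  not_mellHasFinitelyManyPoints_mellLe_one (h.mono fun _ hP => le_trans hP hd)

/-- … nor does the set of all presented points of `M_ell(Q̄)`.
[cite: MochizukiGenEll2010, Ex 1.3 (i) p.5] -/
theorem not_mellHasFinitelyManyPoints_univ : ¬ MellHasFinitelyManyPoints (Set.univ : Set EllPoint) :=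
  fun h => not_mellHasFinitelyManyPoints_mellLe_one (h.mono (Set.subset_univ _))

/-- **F-2758 is a PREDICATE: its universal closure is false** (witness `S = M_ell(Q̄)^{≤1}`, or
`S = univ`).  The printed finiteness statements are its INSTANCES `northcott_htInf` /
`prop34Finite_holds` (tree, `GenEllMellProofs.lean`). [cite: MochizukiGenEll2010, Ex 1.3 (i) p.5] -/
theorem not_forall_mellHasFinitelyManyPoints : ¬ ∀ S : Set EllPoint, MellHasFinitelyManyPoints S :=
  fun h => not_mellHasFinitelyManyPoints_univ (h _)

/-! ## … and it is inhabited: the exact threshold on `M_ell(Q̄)^{≤d}`, finite sets -/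

/-- Every finite set of presented points has finitely many points of `M_ell(Q̄)`.
[cite: MochizukiGenEll2010, Ex 1.3 (i) p.5] -/
theorem MellHasFinitelyManyPoints.of_finite {S : Set EllPoint} (hS : S.Finite) :
    MellHasFinitelyManyPoints S :=
  hS.image _

/-- In particular the empty set does. [cite: MochizukiGenEll2010, Ex 1.3 (i) p.5] -/
theorem mellHasFinitelyManyPoints_empty : MellHasFinitelyManyPoints (∅ : Set EllPoint) :=
  MellHasFinitelyManyPoints.of_finite Set.finite_empty

/-- `M_ell(Q̄)^{≤0}` is empty: a presenting number field has positive degree over `ℚ`.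
[cite: MochizukiGenEll2010, Ex 1.3 (i) p.5] -/
theorem mellLe_zero : MellLe 0 = ∅ :=
  Set.eq_empty_of_forall_notMem fun P hP => (Nat.not_succ_le_zero _) (lt_of_lt_of_le P.degree_pos hP)

/-- … so `M_ell(Q̄)^{≤0}` (vacuously) has finitely many points. [cite: MochizukiGenEll2010, Ex 1.3 (i) p.5] -/
theorem mellHasFinitelyManyPoints_mellLe_zero : MellHasFinitelyManyPoints (MellLe 0) := by
  rw [mellLe_zero]
  exact mellHasFinitelyManyPoints_empty

/-- **Exact threshold of F-2758 on the degree filtration**: `M_ell(Q̄)^{≤d}` has finitely many points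
iff `d = 0`; for `d ≥ 1` a height bound is needed, and with it the statement is the tree's theorem
`northcott_htInf` ([GenEll] Prop. 1.4 (iv)). [cite: MochizukiGenEll2010, Ex 1.3 (i) p.5] -/
theorem mellHasFinitelyManyPoints_mellLe_iff (d : ℕ) : MellHasFinitelyManyPoints (MellLe d) ↔ d = 0 := by
  refine ⟨fun h => ?_, fun h => h ▸ mellHasFinitelyManyPoints_mellLe_zero⟩
  by_contra hd
  exact not_mellHasFinitelyManyPoints_mellLe (Nat.one_le_iff_ne_zero.mpr hd) h

/-- For the record, the decided shape of row F-2758 in one statement: the universal closure fails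
(at `M_ell(Q̄)^{≤1}`) while the printed instance — points of `M_ell(Q̄)^{≤d}` of bounded `ht_∞` —
holds for every `d` and `C` (tree `northcott_htInf`). [cite: MochizukiGenEll2010, Prop 1.4 (iv) p.6] -/
theorem mellHasFinitelyManyPoints_decided :
    (¬ ∀ S : Set EllPoint, MellHasFinitelyManyPoints S) ∧
      ∀ (d : ℕ) (C : ℝ), MellHasFinitelyManyPoints {P | P ∈ MellLe d ∧ P.htInf ≤ C} :=
  ⟨not_forall_mellHasFinitelyManyPoints, northcott_htInf⟩

end Literature.NumberTheory.DiophantineGeometry.GenEll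

end
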